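import Summits.BirchSwinnertonDyer.Rank1Residual.Additive.DefectCountFiniteLevelRankOne
import Summits.BirchSwinnertonDyer.Rank1Residual.X5.KummerRelaxedStrictCount
import HarnessLib

/-!
# The count (C) at finite level from rank-one inputs AND THE NAMED FACTS: the Weil pairing, the
# exceptional set, the residual self-duality of the Kummer structure and the relaxed/strict count at
# `v₀` are DISCHARGED (X5 `KummerRelaxedStrictCount`), leaving a Poitou–Tate family injective at the
# real places, Tate's local Euler characteristic, `#(𝓞_{v₀}/p^m) = p^m`, and the rank-one /
# `Ш` / local-point inputs (cell `b2b-bsdres`, CLASS-CLOSURE lane, class O10 — x1b GEN 37, class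
# lead; file 69 of the series)

HONEST FRAMING (cell `b2b-bsdres`, run/shared/lean/b2b/bsd-rank1-residual/, verbatim in every
file): the goal of the cell is to DELETE the COMBINATION-SHAPED residual classes of the
Birch–Swinnerton-Dyer formula for ALL analytic-rank `≤ 1` elliptic curves over `ℚ` — "full BSD
formula for every rank `≤ 1` curve in class `C`" assembled STRICTLY from published theorems — so
that the rank-`≤ 1` remainder becomes exactly the CONSTRUCTION-SHAPED classes, which are TYPED
(missing-input `Prop`s), NOT attempted. This is not "finishing BSD". CLASS-CLOSURE lane: prove
what is provable now; shrink each hard class to its core with data; no claim beyond stated classes;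
research routes on CONSTRUCTION-SHAPED X12 / O10; census / instrument output = EVIDENCE / conjecture
items, NEVER a Literature fact; `RESIDUAL-MAP.md` marks change only by signed lines. THIS FILE:
TOOL THEOREMS ONLY — no definition, no named Literature fact, no Summits-side fact `def … : Prop`,
no `sorry`, axioms standard; CONDITIONAL (hypotheses) on a family `inv` of local invariant maps with
`IsPerfect`, `SumLocalTermEqZero`, `SelmerComplement` and injective at the real places — the
property list of the tree's named fact `poitouTate_selmerStructure_duality_real` — and on Tate's
local Euler–Poincaré characteristic (named fact `localEulerPoincareCharacteristic`); nothing is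
booked; no label / mark / count / sub-cell moves; (C1_η), (C2_η-GZ), (C3_η) stay typed as filed
(cc-typer-6's pen); O10 stays OPEN / CONSTRUCTION-SHAPED; nothing about `BSD(W, p)` of any pair is
claimed.

## What

**`relIndex_mul_prime_pow_eq_of_rankOne_of_facts`** — file 68's count with `e` (a Weil pairing:
Literature `exists_weilPairing_holds`), `S` (X11b `KummerPT.exists_exceptional_finset`), `hsd` and
input (i) (X5 `dualTransported_kummerSelmerStructure_eq`, `relIndex_kummer_update_bot_update_top_eq`:
`= #E(K_{v₀})[p^m] · #(𝓞_{v₀}/p^m)`, the first factor `= 1` by (loc)) INTERNALISED.  Remaining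
hypotheses: the two fact-shaped ones, `#(𝓞_{v₀}/p^m) = p^m` (`K = ℚ`, `v₀ = p`), and (MW), (Ш), (Γ),
(loc), (span), (kill) of file 68.  Universe: `K : Type` (as X5).

References: [GreenbergLNM1716] §4; [Howard2004HeegnerKolyvagin] Thm. 2.1.11; [MilneADT2006] I Thm.
2.8, Lemma 3.3, Thm. 4.10, §6; [SilvermanAEC2009] III.8.1, VIII.§2, X.§4; [Kobayashi2003] Thm. 9.3.
-/

noncomputable section

open scoped Classical

open CategoryTheory Field Function NumberField IsDedekindDomain WeierstrassCurve
open Literature.NumberTheory.EllipticCurves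
open Literature.NumberTheory.GaloisRepresentations
open Literature.NumberTheory.GaloisRepresentations.DiscreteGaloisModule (mu MuCarrier SelmerStructure
  localTatePairingZMod tateDual localMap)
open Literature.NumberTheory.GaloisCohomology
open Summit.BirchSwinnertonDyer.Rank1Residual.X11b.LocBridge
open Summit.BirchSwinnertonDyer.Rank1Residual.X11b.Levels
open Summit.BirchSwinnertonDyer.Rank1Residual.X5.SelfDualCount
open scoped ContRepresentation

namespace Summit.BirchSwinnertonDyer.Rank1Residual.Additive.DefectCountFiniteLevel

variable {K : Type} [Field K] [NumberField K] (W : WeierstrassCurve K) [W.IsElliptic]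

/-- No `p`-torsion ⟹ the kernel of multiplication by `p^m` is trivial: `#E(K_v)[p^m] = 1`. [folklore] -/
theorem natCard_ker_nsmul_pow_eq_one {A : Type*} [AddCommGroup A] {p m : ℕ}
    (htors : ∀ X : A, p • X = 0 → X = 0) :
    Nat.card (nsmulAddMonoidHom (p ^ m) : A →+ A).ker = 1 := by
  have h : (nsmulAddMonoidHom (p ^ m) : A →+ A).ker = ⊥ := by
    rw [eq_bot_iff]
    intro X hX
    rw [AddMonoidHom.mem_ker, nsmulAddMonoidHom_apply] at hX
    rw [AddSubgroup.mem_bot]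
    exact StrictSha.eq_zero_of_pow_nsmul_eq_zero htors hX
  rw [h, AddSubgroup.card_bot]

/-- **THE COUNT (C) AT FINITE LEVEL FROM RANK-ONE INPUTS AND THE NAMED FACTS.**  `E/K` elliptic,
`p` prime, `m ≥ 1`; `inv` a family of local invariant maps at level `p^m` with `IsPerfect`,
`SumLocalTermEqZero`, `SelmerComplement`, injective at the real places (`hreal`); Tate's local Euler
characteristic at the finite places (`hEP`); a finite place `w₀` with `#(𝓞_{w₀}/p^m) = p^m`; a finite
set `T ∌ w₀` of finite places; `C ≤ H¹(K_{v₀}, E[p^m])`; `𝓖 = 𝓚[v₀ ↦ p^t·C][ℓ ↦ 𝓖_ℓ ⊇ 𝓚_ℓ (ℓ ∈ T)]`;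
and (MW) `P` generates `E(K)/p^m` with order `p^m`, (Ш) `Ш[p^m] ⊆ Ш[p^e]`, (Γ) `E[p^∞]^{Γ_K} = 0`,
(loc) no `p`-torsion in `(W⁄K_{v₀})(K_{v₀})`, `P_{v₀} = p^ν Q` of exact level `ν`, (span)
`C ⊔ 𝓚_{v₀} = ⊤`, (kill) `p^{m−t−ν} 𝓚_{m,ℓ} = 0` (`ℓ ∈ T`), `ν + e ≤ t`, `t + ν ≤ m`.  THEN
**`[H¹_𝓖 : H¹_{𝓚[v₀ ↦ 0]}] · p^{m−t−ν} = #(p^t·C) · ∏_{ℓ ∈ T} [𝓖_ℓ : 𝓚_ℓ]`.**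
File 68 with the Weil pairing (`exists_weilPairing_holds`), the exceptional set
(`X11b.KummerPT.exists_exceptional_finset`), residual self-duality and the relaxed/strict count at `v₀`
(X5 `dualTransported_kummerSelmerStructure_eq`, `relIndex_kummer_update_bot_update_top_eq`)
supplied.  CONDITIONAL on the listed hypotheses; nothing booked.
[cite: GreenbergLNM1716, §4 (pp. 98–103)] [cite: Howard2004HeegnerKolyvagin, Thm. 2.1.11 (arXiv:1202.6340 p. 6)]
[cite: MilneADT2006, Ch. I, Thm. 2.8, Lemma 3.3 and Thm. 4.10] [cite: SilvermanAEC2009, Prop. III.8.1] -/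
theorem relIndex_mul_prime_pow_eq_of_rankOne_of_facts {p m : ℕ} [hp : Fact p.Prime] (hm : 1 ≤ m)
    (inv : LocalInvariants K (p ^ m)) (hperf : inv.IsPerfect) (hvan : inv.SumLocalTermEqZero)
    (hcomp : inv.SelmerComplement)
    (hreal : ∀ w : InfinitePlace K, w.IsReal → Injective (inv (Sum.inl w)))
    (hEP : ∀ v : HeightOneSpectrum (𝓞 K), localEulerPoincareCharacteristic (v.adicCompletion K))
    (w₀ : HeightOneSpectrum (𝓞 K))
    (hOv : Nat.card (w₀.adicCompletionIntegers K ⧸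
      Ideal.span {((p ^ m : ℕ) : w₀.adicCompletionIntegers K)}) = p ^ m)
    (T : Finset (HeightOneSpectrum (𝓞 K))) (hw₀T : w₀ ∉ T)
    (C : AddSubgroup (galoisCohomology ((W.torsionGaloisModule (p ^ m)).toLocal (Sum.inr w₀)) 1))
    {t ν eSha : ℕ} (𝓖 : SelmerStructure (W.torsionGaloisModule (p ^ m)))
    (h𝓖v₀ : 𝓖 (Sum.inr w₀) = C.map (nsmulAddMonoidHom (p ^ t)))
    (h𝓖T : ∀ w ∈ T, W.kummerSelmerStructure ((p ^ m : ℕ) : ℤ) (Sum.inr w) ≤ 𝓖 (Sum.inr w))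
    (h𝓖off : ∀ v : Place K, v ≠ Sum.inr w₀ → (∀ w ∈ T, v ≠ Sum.inr w) →
      𝓖 v = W.kummerSelmerStructure ((p ^ m : ℕ) : ℤ) v)
    -- (MW)
    (hdiv : W.zsmul_geomPoints_surjective) (P : W.toAffine.Point)
    (hgen : ∀ Q : W.toAffine.Point, ∃ a : ℤ,
      Q - a • P ∈ (zsmulAddGroupHom ((p ^ m : ℕ) : ℤ) : W.toAffine.Point →+ _).range)
    (hord : ∀ a : ℤ, a • P ∈ (zsmulAddGroupHom ((p ^ m : ℕ) : ℤ) : W.toAffine.Point →+ _).range →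
      ((p ^ m : ℕ) : ℤ) ∣ a)
    -- (Ш)
    (hSha : ∀ c ∈ W.sha, ((p ^ m : ℕ) : ℤ) • c = 0 → p ^ eSha • c = 0)
    -- (Γ)
    (hΓ : ∀ Q : W.geomPrimaryTorsion p,
      (∀ σ : absoluteGaloisGroup K, X11b.LocBridge.primaryGaloisModule W p σ Q = Q) → Q = 0)
    -- (loc) at `v₀`
    [CharZero (Place.Completion (Sum.inr w₀ : Place K))]
    (htors : ∀ X : (W.baseChange (Place.Completion (Sum.inr w₀ : Place K))).toAffine.Point,
      p • X = 0 → X = 0)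
    {Qv : (W.baseChange (Place.Completion (Sum.inr w₀ : Place K))).toAffine.Point}
    (hPQ : p ^ ν • Qv = Affine.Point.baseChange (W' := W) K (Place.Completion (Sum.inr w₀ : Place K)) P)
    (hexact : ∀ Q' : (W.baseChange (Place.Completion (Sum.inr w₀ : Place K))).toAffine.Point,
      p ^ (ν + 1) • Q' ≠ Affine.Point.baseChange (W' := W) K (Place.Completion (Sum.inr w₀ : Place K)) P)
    -- (span) at `v₀`
    (hCL : C ⊔ W.kummerSelmerStructure ((p ^ m : ℕ) : ℤ) (Sum.inr w₀) = ⊤)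
    -- (kill) at `ℓ ∈ T`
    (hkill : ∀ w ∈ T, ∀ x ∈ W.kummerSelmerStructure ((p ^ m : ℕ) : ℤ) (Sum.inr w),
      p ^ (m - t - ν) • x = 0)
    (het : ν + eSha ≤ t) (htν : t + ν ≤ m) :
    (SelmerStructure.selmerGroup (Function.update (W.kummerSelmerStructure ((p ^ m : ℕ) : ℤ))
          (Sum.inr w₀) ⊥ : SelmerStructure (W.torsionGaloisModule (p ^ m)))).relIndex 𝓖.selmerGroup *
        p ^ (m - t - ν) =
      Nat.card (C.map (nsmulAddMonoidHom (p ^ t))) *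
        ∏ w ∈ T, (W.kummerSelmerStructure ((p ^ m : ℕ) : ℤ) (Sum.inr w)).relIndex (𝓖 (Sum.inr w)) := by
  haveI : NeZero (p ^ m) := ⟨pow_ne_zero m hp.out.ne_zero⟩
  haveI := finite_geomTorsion_of_neZero W (p ^ m)
  have hn : IsPrimePow (p ^ m) := (isPrimePow_nat_iff (p ^ m)).mpr ⟨p, m, hp.out, by omega, rfl⟩
  -- a Weil pairing on `E[p^m]`
  obtain ⟨e, hμ, hadd₁, hadd₂, halt, hnondeg, hgal⟩ := exists_weilPairing_holds W (p ^ m)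
    (hp.out.two_le.trans (Nat.le_self_pow (by omega) p)) (Nat.cast_ne_zero.mpr (NeZero.ne (p ^ m)))
  -- a finite exceptional set `S ⊇ {v₀} ∪ T ∪ ∞ ∪ {v ∣ p} ∪ {bad}`
  obtain ⟨S, hsub, hinf, hpS, hbad⟩ := X11b.KummerPT.exists_exceptional_finset W p
    (insert (Sum.inr w₀ : Place K) (T.image Sum.inr))
  have hw₀ : (Sum.inr w₀ : Place K) ∈ S := hsub (Finset.mem_insert_self _ _)
  have hT : ∀ w ∈ T, (Sum.inr w : Place K) ∈ S := fun w hw =>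
    hsub (Finset.mem_insert_of_mem (Finset.mem_image_of_mem _ hw))
  have hS : ∀ v : HeightOneSpectrum (𝓞 K), (Sum.inr v : Place K) ∉ S →
      (((p ^ m : ℕ) : ℕ) : 𝓞 K) ∉ v.asIdeal ∧
        GaloisRep.IsUnramifiedAt v (W.torsionGaloisModule ((p ^ m : ℕ) : ℤ)) := fun v hv => by
    have hpv : ((p : ℕ) : 𝓞 K) ∉ v.asIdeal := fun h => hv (hpS v h)
    have hgood : W.HasGoodReductionAt v := by_contra fun h => hv (hbad v h)
    have hpkv : ((p ^ m : ℕ) : 𝓞 K) ∉ v.asIdeal := by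
      rw [Nat.cast_pow]
      exact fun h => hpv (v.isPrime.mem_of_pow_mem m h)
    exact ⟨hpkv, X11b.AcSelmer.isUnramifiedAt_torsionGaloisModule W hgood
      (by rw [Int.cast_natCast]; exact hpkv)⟩
  have h𝓚 : SelmerStructure.IsUnramifiedOutside (W.kummerSelmerStructure ((p ^ m : ℕ) : ℤ)) S :=
    X11b.KummerDuality.kummerSelmerStructure_isUnramifiedOutside W p m S hinf hpS hbad
  -- residual self-duality of the Kummer structure (X5)
  have hsd : ∀ v, inv.dualTransported (W.kummerSelmerStructure ((p ^ m : ℕ) : ℤ))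
      (weilDualIntertwining W (p ^ m) e hμ hadd₁ hadd₂ hgal) v =
        W.kummerSelmerStructure ((p ^ m : ℕ) : ℤ) v := fun v =>
    dualTransported_kummerSelmerStructure_eq W (p ^ m) e hμ hadd₁ hadd₂ hgal halt hnondeg inv hn hperf
      hEP hreal v
  -- input (i): the relaxed/strict count at `v₀` (X5) `= #E(K_{v₀})[p^m] · #(𝓞_{v₀}/p^m) = 1 · p^m`
  have hcount := relIndex_kummer_update_bot_update_top_eq W (p ^ m) hn inv hperf hvan hcomp hEP hreal w₀
  have hker : Nat.card (nsmulAddMonoidHom (p ^ m) :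
      (W.baseChange (w₀.adicCompletion K)).toAffine.Point →+ _).ker = 1 :=
    natCard_ker_nsmul_pow_eq_one htors
  rw [hker, one_mul, hOv] at hcount
  exact relIndex_mul_prime_pow_eq_of_rankOne W (p ^ m) e hμ hadd₁ hadd₂ hgal hnondeg inv hperf hvan
    hcomp hS h𝓚 hsd hw₀ T hw₀T hT C rfl hm 𝓖 h𝓖v₀ h𝓖T h𝓖off hcount hdiv P hgen hord hSha hΓ htors
    hPQ hexact hCL hkill het htν

end Summit.BirchSwinnertonDyer.Rank1Residual.Additive.DefectCountFiniteLevel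

end
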